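/-
Origin: expansion seat `planner-pub-hodgecm-pv10-g2-0`, handover #2 2026-08-18T07:14:22Z (`HOME/pub-hodgecm-pv10-g2/lean/Pv10g2/IdeleClassNumber.lean`, md5 34b94070, 270 lines);
landed by the gen-7 packager in gate run 25 as `HodgeCM/PerL34/IdeleClassNumber.lean` (verbatim).
-/
/-
Origin: planner-pub-hodgecm-pv10-g2-0 (unit pub-hodgecm-pv10-g2, DAG-NODE PROVER #10 gen 2), HodgeCM
publication cell, 2026-08-18.  WIP module `Pv10g2.IdeleClassNumber`; intended landing
`HodgeCM/PerL34/IdeleClassNumber.lean` (additive leaf; lands after `NormOneFromClassNumber` (r24)).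
-/
import Mathlib.RingTheory.DedekindDomain.Factorization
import Mathlib.RingTheory.ClassGroup.Basic
import Mathlib.NumberTheory.NumberField.ClassNumber
import Summits.HodgeConjecture.HodgeCM.PerL34.NormOneFromClassNumber

/-!
# (CL) proved: finiteness of the class number, idelic form

Node N15 (the one print input `NormOneIdeleClassesCompact` of PerL v5 tex l. 311), lineage pv10.
`NormOneFromClassNumber.lean` typed
`IdeleClassNumberFinite K : ∃ F finite, ∀ x ∈ 𝔸_K^×, ∃ k ∈ K^×, ∃ y ∈ F, x · k ∈ y · (K_∞^× · ∏_v 𝒪_v^×)`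
(finitely many ideles represent `𝔸_K^×` modulo principal ideles and the unit box) and left it as a
hypothesis.  This file PROVES it in the kernel from Mathlib's finiteness of the class group of the
ring of integers (`NumberField.RingOfIntegers.instFintypeClassGroup`) — Mathlib only, no cited fact,
nothing posited.  The missing glue was the map "finite idele ↦ fractional ideal ↦ ideal class":

* `NumberField.FiniteIdele.ord x v : ℤ` — the order of a finite idele `x` at `v`
  (`|x_v|_v = exp (-ord_v x)` in Mathlib's `ℤᵐ⁰`), additive, zero for almost all `v`;
* `NumberField.FiniteIdele.toFractionalIdeal x = ∏ᶠ_v v ^ (ord_v x)`, with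
  `count_toFractionalIdeal : count K v (toFractionalIdeal x) = ord_v x` (Mathlib
  `FractionalIdeal.count_finprod`), and `count_spanSingleton_eq_neg_log_valuation`: the principal
  idele of `k ∈ K^×` has the multiplicities of the principal fractional ideal `(k)`;
* `NumberField.FiniteIdele.idealClass x ∈ ClassGroup R` and the reduction theorem
  `exists_finset_reduction`: if `ClassGroup R` is finite, finitely many finite ideles `t` represent
  every finite idele as `x = k · t · u` with `k ∈ K^×` and `u` a unit idele (`ord_v u = 0` for all `v`);
* `NumberField.exists_intUnits_of_forall_ord_eq_zero`: a unit idele comes from `(∏_v 𝒪_v)^×`;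
* `NumberField.ideleClassNumberFinite_holds : IdeleClassNumberFinite K` — the lift to `𝔸_K^×`
  along `𝔸_K^× ≃* K_∞^× × 𝔸_{K,f}^×` (`ideleGroupSplitMulEquiv`).

Classical source of the argument: Cassels–Fröhlich, *Algebraic Number Theory* (1967), Ch. II §17
(the map `J_k → I_k`; finiteness of the class group) — used as a GUIDE only; every statement here is
kernel-proved.
-/

set_option autoImplicit false

noncomputable section

open IsDedekindDomain IsDedekindDomain.HeightOneSpectrum
open scoped nonZeroDivisors

/-! ## Finite ideles over a Dedekind domain: orders, fractional ideals, ideal classes -/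

namespace NumberField.FiniteIdele

variable {R : Type*} [CommRing R] [IsDedekindDomain R] {K : Type*} [Field K] [Algebra R K]
  [IsFractionRing R K]

/-- Components of the finite adele `1` are `1`. -/
theorem one_apply (v : HeightOneSpectrum R) : (1 : FiniteAdeleRing R K) v = 1 := rfl

/-- Components are multiplicative. -/
theorem mul_apply (x y : FiniteAdeleRing R K) (v : HeightOneSpectrum R) : (x * y) v = x v * y v := rfl

/-- `x_v · (x⁻¹)_v = 1` for a finite idele `x`. -/
theorem val_apply_mul_inv_apply (x : (FiniteAdeleRing R K)ˣ) (v : HeightOneSpectrum R) :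
    (x : FiniteAdeleRing R K) v * ((x⁻¹ : (FiniteAdeleRing R K)ˣ) : FiniteAdeleRing R K) v = 1 := by
  rw [← mul_apply, ← Units.val_mul, mul_inv_cancel, Units.val_one, one_apply]

/-- Components of a finite idele have non-zero valuation. -/
theorem valued_apply_ne_zero (x : (FiniteAdeleRing R K)ˣ) (v : HeightOneSpectrum R) :
    Valued.v ((x : FiniteAdeleRing R K) v) ≠ 0 := by
  intro h
  have h1 := congrArg Valued.v (val_apply_mul_inv_apply x v)
  rw [map_mul, map_one, h, zero_mul] at h1
  exact zero_ne_one h1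

/-- The **order** `ord_v x ∈ ℤ` of the finite idele `x` at `v`: `|x_v|_v = exp (-ord_v x)`. -/
def ord (x : (FiniteAdeleRing R K)ˣ) (v : HeightOneSpectrum R) : ℤ :=
  -WithZero.log (Valued.v ((x : FiniteAdeleRing R K) v))

/-- (Ported verbatim from the HodgeCMPerL package; no docstring in the source.) -/
theorem valued_apply_eq_exp_neg_ord (x : (FiniteAdeleRing R K)ˣ) (v : HeightOneSpectrum R) :
    Valued.v ((x : FiniteAdeleRing R K) v) = WithZero.exp (-ord x v) := by
  rw [ord, neg_neg, WithZero.exp_log (valued_apply_ne_zero x v)]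

/-- (Ported verbatim from the HodgeCMPerL package; no docstring in the source.) -/
theorem ord_mul (x y : (FiniteAdeleRing R K)ˣ) (v : HeightOneSpectrum R) :
    ord (x * y) v = ord x v + ord y v := by
  simp only [ord, Units.val_mul, mul_apply]
  rw [map_mul, WithZero.log_mul (valued_apply_ne_zero x v) (valued_apply_ne_zero y v)]
  ring

/-- (Ported verbatim from the HodgeCMPerL package; no docstring in the source.) -/
theorem ord_one (v : HeightOneSpectrum R) : ord (1 : (FiniteAdeleRing R K)ˣ) v = 0 := by
  simp only [ord, Units.val_one, one_apply, map_one, WithZero.log_one, neg_zero]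

/-- (Ported verbatim from the HodgeCMPerL package; no docstring in the source.) -/
theorem ord_inv (x : (FiniteAdeleRing R K)ˣ) (v : HeightOneSpectrum R) : ord x⁻¹ v = -ord x v := by
  have h := ord_mul x x⁻¹ v
  rw [mul_inv_cancel, ord_one] at h
  linarith

/-- `ord_v x = 0 ↔ |x_v|_v = 1`. -/
theorem ord_eq_zero_iff (x : (FiniteAdeleRing R K)ˣ) (v : HeightOneSpectrum R) :
    ord x v = 0 ↔ Valued.v ((x : FiniteAdeleRing R K) v) = 1 := by
  rw [valued_apply_eq_exp_neg_ord, ← WithZero.exp_zero, WithZero.exp_inj, neg_eq_zero]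

/-- A finite idele has order `0` at almost all places. -/
theorem ord_eventually_eq_zero (x : (FiniteAdeleRing R K)ˣ) :
    ∀ᶠ v in Filter.cofinite, ord x v = 0 := by
  filter_upwards [FiniteAdeleRing.unitsEquiv_finite_valued_eq_one x] with v hv
  exact (ord_eq_zero_iff x v).2 hv

/-- The order of the principal finite idele of `k ∈ K^×` at `v` is `-log |k|_v`. -/
theorem ord_unitEmbedding (k : Kˣ) (v : HeightOneSpectrum R) :
    ord (FiniteAdeleRing.unitEmbedding R K k) v = -WithZero.log (v.valuation K (k : K)) := by
  rw [ord, FiniteAdeleRing.unitEmbedding_apply, FiniteAdeleRing.algebraMap_apply,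
    valuedAdicCompletion_eq_valuation']

/-- The **fractional ideal** `∏ᶠ_v v ^ (ord_v x)` of a finite idele (a genuine finite product). -/
def toFractionalIdeal (x : (FiniteAdeleRing R K)ˣ) : FractionalIdeal R⁰ K :=
  ∏ᶠ v : HeightOneSpectrum R, (v.asIdeal : FractionalIdeal R⁰ K) ^ ord x v

/-- (Ported verbatim from the HodgeCMPerL package; no docstring in the source.) -/
theorem toFractionalIdeal_ne_zero (x : (FiniteAdeleRing R K)ˣ) : toFractionalIdeal x ≠ 0 := by
  refine finprod_induction (fun I : FractionalIdeal R⁰ K => I ≠ 0) one_ne_zero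
    (fun _ _ h h' => mul_ne_zero h h') fun v => ?_
  exact zpow_ne_zero _ (FractionalIdeal.coeIdeal_ne_zero.mpr v.ne_bot)

/-- The multiplicity of `v` in the fractional ideal of `x` is `ord_v x`. -/
theorem count_toFractionalIdeal (x : (FiniteAdeleRing R K)ˣ) (v : HeightOneSpectrum R) :
    FractionalIdeal.count K v (toFractionalIdeal x) = ord x v :=
  FractionalIdeal.count_finprod K v (ord x) (ord_eventually_eq_zero x)

/-- **`val_v((k)) = ord_v k`**: the multiplicity of `v` in the principal fractional ideal `(k)` of
`k ∈ K^×` is `-log |k|_v` (write `k = n / d` with `n, d ∈ R`). -/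
theorem count_spanSingleton_eq_neg_log_valuation (v : HeightOneSpectrum R) (k : Kˣ) :
    FractionalIdeal.count K v (FractionalIdeal.spanSingleton R⁰ (k : K)) =
      -WithZero.log (v.valuation K (k : K)) := by
  classical
  obtain ⟨n, d, hnd⟩ := IsLocalization.exists_mk'_eq R⁰ (k : K)
  have hd0 : (d : R) ≠ 0 := nonZeroDivisors.ne_zero d.2
  have hn0 : n ≠ 0 := by
    rintro rfl
    apply k.ne_zero
    rw [← hnd, IsLocalization.mk'_zero]
  have hI0 : FractionalIdeal.spanSingleton R⁰ (k : K) ≠ 0 :=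
    FractionalIdeal.spanSingleton_ne_zero_iff.mpr k.ne_zero
  have hI : FractionalIdeal.spanSingleton R⁰ (k : K) =
      FractionalIdeal.spanSingleton R⁰ ((algebraMap R K) d)⁻¹ * ↑(Ideal.span {n} : Ideal R) := by
    rw [FractionalIdeal.coeIdeal_span_singleton, FractionalIdeal.spanSingleton_mul_spanSingleton]
    apply congr_arg
    rw [← hnd, IsFractionRing.mk'_eq_div, div_eq_mul_inv, mul_comm]
  rw [FractionalIdeal.count_well_defined K v hI0 hI, ← hnd, valuation_of_mk',
    intValuation_if_neg v hn0, intValuation_if_neg v hd0, ← WithZero.exp_sub, WithZero.log_exp]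
  ring

/-- (Ported verbatim from the HodgeCMPerL package; no docstring in the source.) -/
theorem ord_unitEmbedding_eq_count (k : Kˣ) (v : HeightOneSpectrum R) :
    ord (FiniteAdeleRing.unitEmbedding R K k) v =
      FractionalIdeal.count K v (FractionalIdeal.spanSingleton R⁰ (k : K)) := by
  rw [ord_unitEmbedding, count_spanSingleton_eq_neg_log_valuation]

/-- The **ideal class** of a finite idele. -/
def idealClass (x : (FiniteAdeleRing R K)ˣ) : ClassGroup R :=
  ClassGroup.mk K (Units.mk0 (toFractionalIdeal x) (toFractionalIdeal_ne_zero x))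

/-- Two finite ideles with the same ideal class differ by a principal idele times a unit idele. -/
theorem exists_ord_eq_zero_of_idealClass_eq {x t : (FiniteAdeleRing R K)ˣ}
    (h : idealClass t = idealClass x) :
    ∃ k : Kˣ, ∀ v, ord (x * t⁻¹ * (FiniteAdeleRing.unitEmbedding R K k)⁻¹) v = 0 := by
  classical
  set It := Units.mk0 (toFractionalIdeal t) (toFractionalIdeal_ne_zero t) with hIt
  set Ix := Units.mk0 (toFractionalIdeal x) (toFractionalIdeal_ne_zero x) with hIx
  have h1 : ClassGroup.mk K (It⁻¹ * Ix) = 1 := by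
    change ClassGroup.mk K It = ClassGroup.mk K Ix at h
    rw [map_mul, map_inv, h, inv_mul_cancel]
  rw [ClassGroup.mk_eq_one_iff] at h1
  obtain ⟨g, hg⟩ := (FractionalIdeal.isPrincipal_iff _).1 h1
  have hg0 : g ≠ 0 := by
    rintro rfl
    rw [FractionalIdeal.spanSingleton_zero] at hg
    exact (It⁻¹ * Ix).ne_zero hg
  refine ⟨Units.mk0 g hg0, fun v => ?_⟩
  have hcount := congrArg (FractionalIdeal.count K v) hg
  rw [Units.val_mul, Units.val_inv_eq_inv_val, Units.val_mk0, Units.val_mk0,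
    FractionalIdeal.count_mul K v (inv_ne_zero (toFractionalIdeal_ne_zero t))
      (toFractionalIdeal_ne_zero x),
    FractionalIdeal.count_inv, count_toFractionalIdeal, count_toFractionalIdeal] at hcount
  rw [ord_mul, ord_mul, ord_inv, ord_inv, ord_unitEmbedding_eq_count, Units.val_mk0, ← hcount]
  ring

/-- **Reduction of finite ideles to a finite set modulo `K^×` and unit ideles** (finiteness of the
class group, idelic form): one representative idele per ideal class containing ideles. -/
theorem exists_finset_reduction [Finite (ClassGroup R)] :
    ∃ T : Finset (FiniteAdeleRing R K)ˣ, ∀ x : (FiniteAdeleRing R K)ˣ, ∃ t ∈ T, ∃ k : Kˣ,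
      ∀ v, ord (x * t⁻¹ * (FiniteAdeleRing.unitEmbedding R K k)⁻¹) v = 0 := by
  classical
  haveI : Fintype (ClassGroup R) := Fintype.ofFinite _
  let rep : ClassGroup R → (FiniteAdeleRing R K)ˣ := fun γ =>
    if hγ : ∃ t : (FiniteAdeleRing R K)ˣ, idealClass t = γ then hγ.choose else 1
  refine ⟨Finset.univ.image rep, fun x => ⟨rep (idealClass x), ?_, ?_⟩⟩
  · exact Finset.mem_image_of_mem rep (Finset.mem_univ _)
  · have hγ : ∃ t : (FiniteAdeleRing R K)ˣ, idealClass t = idealClass x := ⟨x, rfl⟩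
    have hrep : idealClass (rep (idealClass x)) = idealClass x := by
      simp only [rep, dif_pos hγ]
      exact hγ.choose_spec
    exact exists_ord_eq_zero_of_idealClass_eq hrep

end NumberField.FiniteIdele

/-! ## Number fields: the lift to `𝔸_K^×` -/

namespace NumberField

variable (K : Type*) [Field K] [NumberField K]

/-- A finite idele all of whose orders vanish comes from `(∏_v 𝒪_v)^×`. -/
theorem exists_intUnits_of_forall_ord_eq_zero {u : (FiniteAdeleRing (𝓞 K) K)ˣ}
    (hu : ∀ v, FiniteIdele.ord u v = 0) :
    ∃ u' : (integralAdeles K)ˣ,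
      Units.map (structureRingHom K : integralAdeles K →* FiniteAdeleRing (𝓞 K) K) u' = u := by
  have h1 : ∀ v, (u : FiniteAdeleRing (𝓞 K) K) v ∈ v.adicCompletionIntegers K := fun v =>
    (mem_adicCompletionIntegers (𝓞 K) K v).2 (le_of_eq ((FiniteIdele.ord_eq_zero_iff u v).1 (hu v)))
  have h2 : ∀ v, ((u⁻¹ : (FiniteAdeleRing (𝓞 K) K)ˣ) : FiniteAdeleRing (𝓞 K) K) v ∈
      v.adicCompletionIntegers K := fun v =>
    (mem_adicCompletionIntegers (𝓞 K) K v).2 (le_of_eq ((FiniteIdele.ord_eq_zero_iff u⁻¹ v).1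
      (by rw [FiniteIdele.ord_inv, hu, neg_zero])))
  let a : integralAdeles K := fun v => ⟨_, h1 v⟩
  let b : integralAdeles K := fun v => ⟨_, h2 v⟩
  have hab : a * b = 1 := funext fun v => Subtype.ext (FiniteIdele.val_apply_mul_inv_apply u v)
  have hba : b * a = 1 := by rw [mul_comm]; exact hab
  exact ⟨⟨a, b, hab, hba⟩, Units.ext (FiniteAdeleRing.ext K fun v => rfl)⟩

/-- `𝔸_{K,f}^× → 𝔸_K^×`, `t ↦ (1, t)`. -/
def finUnitsToIdele : (FiniteAdeleRing (𝓞 K) K)ˣ →* ideleGroup K :=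
  (ideleGroupSplitMulEquiv K).symm.toMonoidHom.comp (MonoidHom.inr _ _)

/-- (Ported verbatim from the HodgeCMPerL package; no docstring in the source.) -/
theorem ideleGroupSplitMulEquiv_finUnitsToIdele (t : (FiniteAdeleRing (𝓞 K) K)ˣ) :
    ideleGroupSplitMulEquiv K (finUnitsToIdele K t) = (1, t) :=
  MulEquiv.apply_symm_apply _ _

/-- The principal idele of `k ∈ K^×`. -/
def principalIdele : Kˣ →* ideleGroup K :=
  Units.map (algebraMap K (AdeleRing (𝓞 K) K) : K →* AdeleRing (𝓞 K) K)

/-- (Ported verbatim from the HodgeCMPerL package; no docstring in the source.) -/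
theorem principalIdele_mem_principalIdeles (k : Kˣ) : principalIdele K k ∈ principalIdeles K :=
  ⟨k, rfl⟩

/-- Under `𝔸_K^× ≃* K_∞^× × 𝔸_{K,f}^×` the principal idele of `k` is `(k_∞, k_f)`. -/
theorem ideleGroupSplitMulEquiv_principalIdele (k : Kˣ) :
    ideleGroupSplitMulEquiv K (principalIdele K k) =
      (Units.map (algebraMap K (InfiniteAdeleRing K) : K →* InfiniteAdeleRing K) k,
        FiniteAdeleRing.unitEmbedding (𝓞 K) K k) :=
  Prod.ext (Units.ext rfl) (Units.ext rfl)

/-- **(CL) holds** (KERNEL, Mathlib only): finitely many ideles represent `𝔸_K^×` modulo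
`K^× · (K_∞^× · ∏_v 𝒪_v^×)`. -/
theorem ideleClassNumberFinite_holds : IdeleClassNumberFinite K := by
  classical
  obtain ⟨T, hT⟩ := FiniteIdele.exists_finset_reduction (R := 𝓞 K) (K := K)
  refine ⟨T.image (finUnitsToIdele K), fun x => ?_⟩
  obtain ⟨t, ht, k, hk⟩ := hT (ideleGroupSplitMulEquiv K x).2
  obtain ⟨u', hu'⟩ := exists_intUnits_of_forall_ord_eq_zero K hk
  refine ⟨(principalIdele K k)⁻¹, inv_mem (principalIdele_mem_principalIdeles K k),
    finUnitsToIdele K t, Finset.mem_image_of_mem _ ht,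
    ((ideleGroupSplitMulEquiv K x).1 *
      (Units.map (algebraMap K (InfiniteAdeleRing K) : K →* InfiniteAdeleRing K) k)⁻¹, u'), ?_⟩
  apply (ideleGroupSplitMulEquiv K).injective
  rw [map_mul, map_inv, ideleGroupSplitMulEquiv_principalIdele, map_mul, unitBox_apply,
    infUnitsToIdele_mul_intUnitsToIdele, ideleGroupSplitMulEquiv_finUnitsToIdele,
    MulEquiv.apply_symm_apply, hu', Prod.inv_mk, Prod.ext_iff]
  refine ⟨?_, ?_⟩
  · simp only [Prod.fst_mul, one_mul]
  · simp only [Prod.snd_mul]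
    rw [mul_assoc _ t⁻¹, mul_left_comm t, mul_inv_cancel_left]

end NumberField

end
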